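/-
Copyright (c) 2026. All rights reserved.
Released under Apache 2.0 license as described in the file LICENSE.
Authors: abc-iut cell, wave-4 seat abc-iut-w4-d085 (L3 sub-DAG Thm 5.4, coordinator assembly of (ii) at LEVEL A).
-/
import Literature.AnabelianGeometry.SemiGraphs.ArithMaximalCompactThm54iiAssembly
import Literature.AnabelianGeometry.SemiGraphs.ArithIntersectionOfAction
import Literature.AnabelianGeometry.SemiGraphs.ArithChartActionAmple
import HarnessLib

/-!
# [SemiAnbd] Theorem 5.4 (ii) at LEVEL A: the decomposition data produced from the tempered chart

Mochizuki, *Semi-graphs of anabelioids*, Publ. RIMS **42** (2006), §5, Theorem 5.4 (ii) p. 66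
[cite: MochizukiSemiAnbd2006, Thm 5.4 (ii), p. 66]. PROOF-ONLY (no definition). The sub-DAG rows of
Thm 5.4 (HOME/plan/L3/SUBDAG-SemiAnbd-Thm54.md) are COMPOSED BY NAME over the decomposition data
`decompositionDataOfChart R ι` PRODUCED (abc-iut-w4-d053, `ArithDecompositionData.lean`) from a tempered
chart `c` of the geometric semi-graph of anabelioids `𝒢`, representatives `R` of its §3 verticial /
edge-like subgroups, the inclusion `ι : Π^temp_𝔾 = c.G ↪ Π^temp_𝔊 = Gtp` with `ι(Π^temp_𝔾) = Ker aug`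
(Prop 5.2 (iv)) and the arithmetic-action package `ArithChartAction c ι aug actV actE actB` (Def 5.1 (i)):

* `arithMaximalCompactStatementII_ofChart_of_hEV` — Thm 5.4 (ii) for the produced data from Thm 5.4 (i)
  (`hI`, row T54-3), Rmk 5.3.1's first sentence (`hR`, row T54-1) and the single data-level input hEV
  (every edge-like subgroup is the intersection of two distinct verticial ones), with hVE DISCHARGED at
  LEVEL A (abc-iut-w4-d040, `not_isEdgeLike_of_isVerticial_ofChart_of_action`: Rmk 5.3.1's second
  sentence for the produced data + Thm 3.7 "no verticial subgroup of `π₁^temp(𝒢)` is edge-like");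
* `arithMaximalCompactStatementII_ofChart` — the same with hEV REPLACED by its sub-DAG derivation WITHOUT
  level data: hβ₁ at LEVEL A (abc-iut-w4-d040, `hβ₁_ofChart`, row T54-4d, input `hCE`), hβ₂ from the
  commensurator description of the branch groups (`hcommB`, p. 65; `isEdgeLike_eq_of_le`) and the geometric
  incomparability of edge-like subgroups (`map_edgeLike_eq_of_le`, Thm 3.7 (iii) `CompactInVerticial` and
  the tree's `verticialDistinct_holds` / `verticialInjective_holds`);
* `arithMaximalCompactStatementII_ofChartAction` — the same with `hR` REPLACED by its LEVEL-A derivation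
  (abc-iut-w4-d029, `ArithChartAction.verticialEdgeLikeCompactAmple`, row T54-1) from the action package,
  surjectivity of `aug`, the pair-conjugation property `hconjPair` and the LEVEL-B compactness inputs
  `hVc` / `hBc` (plan/GAP-LEDGER G-w4d053-1);
(The produced-data umbrella of Thm 5.4 (i) ∧ (ii) over the level-data package `ArithLevelData` is
abc-iut-w4-d040's `arithMaximalCompactStatementI_and_II_ofChart`, `ArithThm54OfChart.lean`; coordinator
ruling R25.)

Every remaining binder is a producer-level input named by its row; nothing here asserts any of them.
Typed ≠ proved for the inputs; nothing here bears on [IUTchIII] Cor. 3.12.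
-/

namespace Literature.AnabelianGeometry.SemiGraphs

namespace ProfiniteSemiGraph

universe u u' u''

variable {𝒢 : ProfiniteSemiGraph.{u}} {c : TemperedPiChart 𝒢}

variable {Gtp : Type u'} [Group Gtp] [TopologicalSpace Gtp] [T2Space Gtp]
variable {PA : Type u''} [Group PA] [TopologicalSpace PA]

/-- **[SemiAnbd] Thm 5.4 (ii) for the decomposition data produced from the tempered chart, modulo (i),
Rmk 5.3.1 (first sentence) and hEV**: "the arithmetically maximal compact subgroups of `Π^temp_𝔊` are
precisely the verticial subgroups; the edge-like subgroups are precisely the arithmetically ample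
intersections of two distinct such" — `arithMaximalCompactStatementII_of'` with hVE DISCHARGED at LEVEL A
from the action package (`not_isEdgeLike_of_isVerticial_ofChart_of_action`).
[cite: MochizukiSemiAnbd2006, Thm 5.4 (ii), p. 66] -/
theorem arithMaximalCompactStatementII_ofChart_of_hEV (hCV : CompactInVerticial.{u})
    (h𝒢 : 𝒢.Thm37Hypotheses) (hG : 𝒢.graph.IsGraph) (R : ChartRepresentatives c) (ι : c.G →* Gtp)
    (hι : Function.Injective ι) (aug : Gtp →* PA) (hexact : ι.range = aug.ker)
    {actV : PA → 𝒢.graph.Vertex → 𝒢.graph.Vertex} {actE : PA → 𝒢.graph.Edge → 𝒢.graph.Edge}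
    {actB : PA → 𝒢.graph.Branch → 𝒢.graph.Branch} (hA : ArithChartAction c ι aug actV actE actB)
    (hI : ArithMaximalCompactStatementI (decompositionDataOfChart R ι) aug)
    (hR : VerticialEdgeLikeCompactAmpleStatement (decompositionDataOfChart R ι) aug)
    (hEV : ∀ K : Subgroup Gtp, IsEdgeLike (decompositionDataOfChart R ι) K →
      ∃ W₁ W₂ : Subgroup Gtp, IsVerticial (decompositionDataOfChart R ι) W₁ ∧
        IsVerticial (decompositionDataOfChart R ι) W₂ ∧ W₁ ≠ W₂ ∧ K = W₁ ⊓ W₂) :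
    Literature.AnabelianGeometry.SemiGraphs.ArithMaximalCompactStatementII
      (decompositionDataOfChart R ι) aug :=
  arithMaximalCompactStatementII_of' hI hR
    (fun _ hK => not_isEdgeLike_of_isVerticial_ofChart_of_action hCV h𝒢 hG R ι hι aug hexact hA hK) hEV

/-- **[SemiAnbd] Thm 5.4 (ii) for the decomposition data produced from the tempered chart, modulo (i) and
Rmk 5.3.1 (first sentence)**, with hEV DERIVED along the sub-DAG without level data: hβ₁ at LEVEL A
(`hβ₁_ofChart`, input `hCE`: along `ι`, commensurators grow from an edge-like subgroup to a verticial
host), hβ₂ from the commensurator description `hcommB` of the branch groups (p. 65) and the geometric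
incomparability of edge-like subgroups (Thm 3.7 (iii), `CompactInVerticial`); Rmk 5.3.1's second sentence
and hVE for the produced data from the action package (rows T54-2/T54-4e).
[cite: MochizukiSemiAnbd2006, Thm 5.4 (ii), p. 66] -/
theorem arithMaximalCompactStatementII_ofChart (hCV : CompactInVerticial.{u})
    (h𝒢 : 𝒢.Thm37Hypotheses) (hG : 𝒢.graph.IsGraph) (R : ChartRepresentatives c) (ι : c.G →* Gtp)
    (hι : Function.Injective ι) (aug : Gtp →* PA) (hexact : ι.range = aug.ker)
    {actV : PA → 𝒢.graph.Vertex → 𝒢.graph.Vertex} {actE : PA → 𝒢.graph.Edge → 𝒢.graph.Edge}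
    {actB : PA → 𝒢.graph.Branch → 𝒢.graph.Branch} (hA : ArithChartAction c ι aug actV actE actB)
    (hI : ArithMaximalCompactStatementI (decompositionDataOfChart R ι) aug)
    (hR : VerticialEdgeLikeCompactAmpleStatement (decompositionDataOfChart R ι) aug)
    (hcommB : ∀ b : 𝒢.graph.Branch,
      Subgroup.Commensurable.commensurator ((decompositionDataOfChart R ι).brGp b ⊓ aug.ker) =
        (decompositionDataOfChart R ι).brGp b)
    (hCE : ∀ (e : 𝒢.graph.Edge) (v : 𝒢.graph.Vertex) (L H : Subgroup c.G),
      L ∈ edgeLikeSubgroups c e → H ∈ verticialSubgroups c v → L ≤ H →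
        Subgroup.Commensurable.commensurator (L.map ι) ≤
          Subgroup.Commensurable.commensurator (H.map ι)) :
    Literature.AnabelianGeometry.SemiGraphs.ArithMaximalCompactStatementII
      (decompositionDataOfChart R ι) aug :=
  arithMaximalCompactStatementII_of_geometric hI hR
    (intersectionWithGeometricStatement_ofChart_of_action hCV h𝒢 hG R ι hι aug hexact hA)
    (fun K hKV => isGeomVerticial_not_isGeomEdgeLike h𝒢 c ι hι K hKV)
    (fun _ _ hL hL' hle =>
      map_edgeLike_eq_of_le c ι hCV verticialDistinct_holds verticialInjective_holds h𝒢 hι hL hL' hle)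
    hcommB (hβ₁_ofChart h𝒢 hG R ι hι hCE)

/-- **[SemiAnbd] Thm 5.4 (ii) for the decomposition data produced from the tempered chart, modulo (i)**,
with Rmk 5.3.1's first sentence DERIVED at LEVEL A (row T54-1, `ArithChartAction.verticialEdgeLikeCompactAmple`)
from the action package (conjugation by `g ∈ Π^temp_𝔊` permutes the §3 verticial / edge-like subgroups as
`aug g` permutes vertices / edges; an open subgroup of `Π_A` acts trivially), surjectivity of `aug`, the
pair-conjugation property `hconjPair` and the LEVEL-B compactness of the produced vertex / branch groups.
[cite: MochizukiSemiAnbd2006, Thm 5.4 (ii), p. 66] -/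
theorem arithMaximalCompactStatementII_ofChartAction [IsTopologicalGroup Gtp] [IsTopologicalGroup PA]
    (hCV : CompactInVerticial.{u})
    (h𝒢 : 𝒢.Thm37Hypotheses) (hG : 𝒢.graph.IsGraph) (R : ChartRepresentatives c) (ι : c.G →* Gtp)
    (hι : Function.Injective ι) (aug : Gtp →* PA) (hexact : ι.range = aug.ker)
    (hsurj : Function.Surjective aug)
    {actV : PA → 𝒢.graph.Vertex → 𝒢.graph.Vertex} {actE : PA → 𝒢.graph.Edge → 𝒢.graph.Edge}
    {actB : PA → 𝒢.graph.Branch → 𝒢.graph.Branch} (hA : ArithChartAction c ι aug actV actE actB)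
    (hconjPair : ∀ (b : 𝒢.graph.Branch) (v : 𝒢.graph.Vertex), 𝒢.graph.abuts b = some v →
      ∃ U : Subgroup PA, IsOpen (U : Set PA) ∧ ∀ a ∈ U, ∃ g : Gtp, aug g = a ∧ ∃ h : c.G,
        conjSubgroup g ((R.Hv v).map ι) = conjSubgroup (ι h) ((R.Hv v).map ι) ∧
          conjSubgroup g ((R.Hb b).map ι) = conjSubgroup (ι h) ((R.Hb b).map ι))
    (hVc : ∀ v, IsCompact (arithVertGp R ι v : Set Gtp))
    (hBc : ∀ b, IsCompact (arithBrGp R ι b : Set Gtp))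
    (hI : ArithMaximalCompactStatementI (decompositionDataOfChart R ι) aug)
    (hcommB : ∀ b : 𝒢.graph.Branch,
      Subgroup.Commensurable.commensurator ((decompositionDataOfChart R ι).brGp b ⊓ aug.ker) =
        (decompositionDataOfChart R ι).brGp b)
    (hCE : ∀ (e : 𝒢.graph.Edge) (v : 𝒢.graph.Vertex) (L H : Subgroup c.G),
      L ∈ edgeLikeSubgroups c e → H ∈ verticialSubgroups c v → L ≤ H →
        Subgroup.Commensurable.commensurator (L.map ι) ≤
          Subgroup.Commensurable.commensurator (H.map ι)) :
    Literature.AnabelianGeometry.SemiGraphs.ArithMaximalCompactStatementII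
      (decompositionDataOfChart R ι) aug :=
  -- `aug ∘ ι = 1` from exactness
  have hιaug : ∀ h : c.G, aug (ι h) = 1 := fun h =>
    (MonoidHom.mem_ker).mp (hexact ▸ ⟨h, rfl⟩ : ι h ∈ aug.ker)
  arithMaximalCompactStatementII_ofChart hCV h𝒢 hG R ι hι aug hexact hA hI
    (hA.verticialEdgeLikeCompactAmple R hιaug hsurj hG hconjPair hVc hBc) hcommB hCE

end ProfiniteSemiGraph

end Literature.AnabelianGeometry.SemiGraphs
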